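import Summits.NavierStokesRegularity.FluidComputer.PalasekTowerLundgrenChildSwirlRelaxation

/-!
# REGISTER v2.3″ (continued): THE EVENTUAL SPEED CEILING of a Lundgren-carried child with ANY positive
# log-tame cross-section — `‖swirl(s)‖_∞ ≤ (1/(4π) + 0.52 (2H₀/Γ)^{1/4} e^{−λA_k s/4}) · Γ (λA_k)^{1/2}`

Cell `ns-blowup`, seat `ns-blowup-ecbridge-8` (g9); evidence toward crux 19250 `HeredityFromTwo`, UPPER half
(`stub_window_ceiling` / `WindowCeilingAt k`, speed part) and the speed floor's band, MODEL lane «child core =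
cross-section of Lundgren's stretched flow in the host strain `c = λA_k` at `ν = 1`, ANY positive log-tame
profile» (setting of `PalasekTowerLundgrenChildSwirlRelaxation`).

g8's any-profile speed ceiling is UNIFORM IN TIME: `‖swirl(s)‖_∞ ≤ (63/50)(4π)^{−1/2}·Γc^{1/2} ≤ 0.3556·Γc^{1/2}`
after one strain time (`…CeilingNumeric`, from `‖ω̃‖_∞ ≤ Γ/τ` and the sharp kinematic bound). The entropy clock
improves it EVENTUALLY: the child's swirl is within `0.52(2H₀/Γ)^{1/4}e^{−cs/4}·Γc^{1/2}` of the Biot–Savart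
swirl of the Burgers cross-section (`…_childSwirl_relaxation_after_one_strain_time`), and that steady field is
bounded by the sharp one-signed kinematic bound `‖K₂ ∗ w‖_∞ ≤ (‖w‖_∞‖w‖₁/4π)^{1/2}`
(`norm_biotSavart2D_le_sqrt_of_nonneg`, Iftimie–Sideris–Gamblin) with `‖ω_B‖_∞ = Γc/(4π)`, `‖ω_B‖₁ = Γ`:

* `norm_biotSavart2D_burgersSlice_le` — **`‖(K₂ ∗ ω_B)(y)‖ ≤ Γ c^{1/2}/(4π)`** (`Γ ≥ 0`, `c > 0`);
* `palasekTowerBreakdown_anyProfile_childSwirl_ceiling_clock` — for `cs ≥ 1`: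
  **`‖e^{cs/2} ṽ(τ(s), e^{cs/2}y)‖ ≤ Γc^{1/2}/(4π) + 0.52·(Γc)^{1/2}(2ΓH₀)^{1/4}e^{−cs/4}`**;
* `palasekTowerBreakdown_anyProfile_childSwirl_ceiling_threshold` — once moreover
  `0.52(2ΓH₀)^{1/4} ≤ δΓ^{1/2}e^{cs/4}`: **`‖swirl(s, y)‖ ≤ (1/(4π) + δ)·Γ(λA_k)^{1/2} ≤ (0.0796 + δ)·Γ(λA_k)^{1/2}`**.

REGISTER READING. The any-profile SPEED CEILING thus drops from `0.3556` (uniform, g8) to `0.0796 + δ` after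
`λA_k s ≥ log(0.1462·H₀/Γ) + 4 log(1/δ)` strain times — within the factor `π/2 ≈ 1.57` of the Burgers peak
`≈ 0.0508·Γc^{1/2}` (`BurgersVortexPeakSpeed`; the residual factor is the price of not evaluating `K₂ ∗ ω_B`
in closed form). WHAT THIS IS NOT: not NS about registered flows; no Stage; positivity/log-tameness are
hypotheses; this bounds the SWIRL part `e^{cs/2}ṽ` of the child's velocity (the strain field `c(−½y, z)` and the
axial component are separate, as in all `…ChildSwirl…` files).

## References
* [cite: GallayWayne2005, §3.4 (arXiv:math/0402449 p. 14)] · [cite: IftimieSiderisGamblin1999, Lemma 2.1]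
* [cite: MajdaBertozziCUP2002, §8.2.3 Prop. 8.2 (i) (8.27)] · [cite: Frisch1995, §8.9.1 eq. (8.140)]
-/

noncomputable section

namespace Summit.NavierStokesRegularity.FluidComputer.PalasekTowerClayBridge

open Real Set MeasureTheory
open Literature.Analysis.FluidPDE Literature.Analysis.FluidPDE.Lundgren

variable {S' : Set ℝ}
  {v : ℝ → EuclideanSpace ℝ (Fin 2) → EuclideanSpace ℝ (Fin 2)}
  {q : ℝ → EuclideanSpace ℝ (Fin 2) → ℝ}

/-! ### §1 The Biot–Savart swirl of the Burgers cross-section is bounded by `Γ c^{1/2}/(4π)` -/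

/-- **`‖(K₂ ∗ ω_B)(y)‖ ≤ Γ c^{1/2}/(4π)`** for the Burgers cross-section `ω_B = burgersVorticity c 1 Γ ∘ ι`
(`c > 0`, `Γ ≥ 0`): the sharp one-signed kinematic bound `(‖ω_B‖_∞ ‖ω_B‖₁/4π)^{1/2}` with
`‖ω_B‖_∞ = Γc/(4π)` (`burgersVorticity_le_axis`) and `‖ω_B‖₁ = Γ` (`integral_burgersVorticity`).
[cite: IftimieSiderisGamblin1999, Lemma 2.1; Frisch1995, §8.9.1 eq. (8.140)] -/
theorem norm_biotSavart2D_burgersSlice_le {c Γ : ℝ} (hc : 0 < c) (hΓ : 0 ≤ Γ)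
    (y : EuclideanSpace ℝ (Fin 2)) :
    ‖biotSavart2D (fun y' => burgersVorticity c 1 Γ (embedXY y')) y‖ ≤ Γ * Real.sqrt c / (4 * π) := by
  have hslice : ∀ y' : EuclideanSpace ℝ (Fin 2),
      burgersVorticity c 1 Γ (embedXY y') = burgersVorticity c 1 Γ (horizLift y' 0) := fun y' => by
    unfold burgersVorticity; simp
  have hint : ∫ y', burgersVorticity c 1 Γ (embedXY y') = Γ := by
    simp_rw [hslice]; exact integral_burgersVorticity hc one_pos Γ 0
  have hwi : Integrable (fun y' : EuclideanSpace ℝ (Fin 2) => burgersVorticity c 1 Γ (embedXY y')) := by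
    by_cases hΓ0 : Γ = 0
    · have : (fun y' : EuclideanSpace ℝ (Fin 2) => burgersVorticity c 1 Γ (embedXY y')) = fun _ => 0 := by
        funext y'; unfold burgersVorticity; simp [hΓ0]
      rw [this]; exact integrable_zero _ _ _
    · refine Integrable.of_integral_ne_zero ?_
      rw [hint]; exact hΓ0
  have h0 : ∀ y', 0 ≤ burgersVorticity c 1 Γ (embedXY y') := fun y' => by
    unfold burgersVorticity; positivity
  have hA : ∀ y', burgersVorticity c 1 Γ (embedXY y') ≤ c * Γ / (4 * π * 1) := fun y' =>
    burgersVorticity_le_axis hc one_pos hΓ _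
  refine (norm_biotSavart2D_le_sqrt_of_nonneg hwi h0 hA y).trans (le_of_eq ?_)
  rw [hint, show c * Γ / (4 * π * 1) * Γ / (4 * π) = (Γ / (4 * π)) ^ 2 * c by ring,
    Real.sqrt_mul' _ hc.le, Real.sqrt_sq (by positivity)]
  ring

/-- `1/(4π) ≤ 0.0796`. [folklore] -/
private theorem inv_four_pi_le_d4 : (4 * π)⁻¹ ≤ 0.0796 := by
  have hπ : 3.141592 < π := pi_gt_d6
  rw [inv_le_comm₀ (by positivity) (by norm_num)]
  norm_num
  linarith

/-! ### §2 The eventual any-profile speed ceiling -/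

/-- **THE EVENTUAL SPEED CEILING, ANY POSITIVE LOG-TAME PROFILE** (setting of
`palasekTowerBreakdown_anyProfile_childSwirl_relaxation`; `cs ≥ 1`): for every `y`,
`‖e^{cs/2} ṽ(τ(s), e^{cs/2}y)‖ ≤ Γc^{1/2}/(4π) + 0.52·(Γc)^{1/2}(2ΓH₀)^{1/4} e^{−cs/4}`
— triangle inequality between `…_childSwirl_relaxation_after_one_strain_time` and §1.
[cite: GallayWayne2005, §3.4; IftimieSiderisGamblin1999, Lemma 2.1] -/
theorem palasekTowerBreakdown_anyProfile_childSwirl_ceiling_clock (R : TowerRates) (k : ℕ)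
    {l : ℝ} (hl : 0 < l) (hS' : Convex ℝ S') (hv : IsClassicalNSSolutionOn S' 1 0 v q)
    (hω : HasUniformRapidDecayOn S' (fun σ η => PlanarEigenmode.vorticity (v σ) η))
    (hBS : ∀ σ ∈ S', ∀ η, v σ η = biotSavart2D (PlanarEigenmode.vorticity (v σ)) η)
    (hpos : ∀ σ ∈ S', ∀ η, 0 < PlanarEigenmode.vorticity (v σ) η) {L : ℝ} {m : ℕ}
    (hlog : ∀ σ ∈ S', ∀ η, |Real.log (PlanarEigenmode.vorticity (v σ) η)| ≤ L * (1 + ‖η‖) ^ m)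
    (hsc : ∀ σ ∈ S', ∀ η, ‖fderiv ℝ (PlanarEigenmode.vorticity (v σ)) η‖ ≤
      L * (1 + ‖η‖) ^ m * PlanarEigenmode.vorticity (v σ) η)
    (h0 : (0 : ℝ) ∈ S') {s : ℝ} (hs1 : 1 ≤ l * R.A k * s)
    (hτs : (exp (l * R.A k * s) - 1) / (l * R.A k) ∈ S') (y : EuclideanSpace ℝ (Fin 2)) :
    ‖exp (l * R.A k * s / 2) • v ((exp (l * R.A k * s) - 1) / (l * R.A k)) (exp (l * R.A k * s / 2) • y)‖ ≤
      (∫ η, PlanarEigenmode.vorticity (v 0) η) * Real.sqrt (l * R.A k) / (4 * π) +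
        0.52 * Real.sqrt ((∫ η, PlanarEigenmode.vorticity (v 0) η) * (l * R.A k)) *
          Real.sqrt (Real.sqrt (2 * (∫ η, PlanarEigenmode.vorticity (v 0) η) *
            ∫ η, PlanarEigenmode.vorticity (v 0) η *
              Real.log (PlanarEigenmode.vorticity (v 0) η /
                ((∫ y, PlanarEigenmode.vorticity (v 0) y) / (4 * π * (l * R.A k)⁻¹) *
                  exp (-(‖η‖ ^ 2 / (4 * (l * R.A k)⁻¹))))))) *
          exp (-(l * R.A k * s / 4)) := by
  have hcpos : 0 < l * R.A k := mul_pos hl (R.A_pos k)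
  have hΓ0 : 0 ≤ ∫ η, PlanarEigenmode.vorticity (v 0) η := integral_nonneg fun η => (hpos 0 h0 η).le
  have hrel := palasekTowerBreakdown_anyProfile_childSwirl_relaxation_after_one_strain_time R k hl hS' hv hω
    hBS hpos hlog hsc h0 hs1 hτs y
  have hB := norm_biotSavart2D_burgersSlice_le hcpos hΓ0 y
  have htri := norm_le_norm_add_norm_sub'
    (exp (l * R.A k * s / 2) • v ((exp (l * R.A k * s) - 1) / (l * R.A k)) (exp (l * R.A k * s / 2) • y))
    (biotSavart2D (fun y' => burgersVorticity (l * R.A k) 1 (∫ η, PlanarEigenmode.vorticity (v 0) η)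
      (embedXY y')) y)
  linarith

/-- **THE EVENTUAL SPEED CEILING AS A NUMBER** (same setting; `cs ≥ 1`): once
`0.52 (2ΓH₀)^{1/4} ≤ δ Γ^{1/2} e^{cs/4}` (after `λA_k s ≥ log(0.1462·H₀/Γ) + 4 log(1/δ)` strain times),
**`‖swirl(s, y)‖ ≤ (0.0796 + δ) · Γ (λA_k)^{1/2}`** at every `y` — against the uniform `0.3556·Γ(λA_k)^{1/2}` of
`…_childSwirl_le_after_one_strain_time_anyProfile_sharp`; the Burgers peak is `≈ 0.0508·Γ(λA_k)^{1/2}`.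
[cite: GallayWayne2005, §3.4; IftimieSiderisGamblin1999, Lemma 2.1] -/
theorem palasekTowerBreakdown_anyProfile_childSwirl_ceiling_threshold (R : TowerRates) (k : ℕ)
    {l : ℝ} (hl : 0 < l) (hS' : Convex ℝ S') (hv : IsClassicalNSSolutionOn S' 1 0 v q)
    (hω : HasUniformRapidDecayOn S' (fun σ η => PlanarEigenmode.vorticity (v σ) η))
    (hBS : ∀ σ ∈ S', ∀ η, v σ η = biotSavart2D (PlanarEigenmode.vorticity (v σ)) η)
    (hpos : ∀ σ ∈ S', ∀ η, 0 < PlanarEigenmode.vorticity (v σ) η) {L : ℝ} {m : ℕ}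
    (hlog : ∀ σ ∈ S', ∀ η, |Real.log (PlanarEigenmode.vorticity (v σ) η)| ≤ L * (1 + ‖η‖) ^ m)
    (hsc : ∀ σ ∈ S', ∀ η, ‖fderiv ℝ (PlanarEigenmode.vorticity (v σ)) η‖ ≤
      L * (1 + ‖η‖) ^ m * PlanarEigenmode.vorticity (v σ) η)
    (h0 : (0 : ℝ) ∈ S') {s : ℝ} (hs1 : 1 ≤ l * R.A k * s)
    (hτs : (exp (l * R.A k * s) - 1) / (l * R.A k) ∈ S') {δ : ℝ}
    (hclock : 0.52 * Real.sqrt (Real.sqrt (2 * (∫ η, PlanarEigenmode.vorticity (v 0) η) *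
          ∫ η, PlanarEigenmode.vorticity (v 0) η *
            Real.log (PlanarEigenmode.vorticity (v 0) η /
              ((∫ y, PlanarEigenmode.vorticity (v 0) y) / (4 * π * (l * R.A k)⁻¹) *
                exp (-(‖η‖ ^ 2 / (4 * (l * R.A k)⁻¹))))))) ≤
        δ * Real.sqrt (∫ η, PlanarEigenmode.vorticity (v 0) η) * exp (l * R.A k * s / 4))
    (y : EuclideanSpace ℝ (Fin 2)) :
    ‖exp (l * R.A k * s / 2) • v ((exp (l * R.A k * s) - 1) / (l * R.A k)) (exp (l * R.A k * s / 2) • y)‖ ≤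
      (0.0796 + δ) * ((∫ η, PlanarEigenmode.vorticity (v 0) η) * Real.sqrt (l * R.A k)) := by
  set c : ℝ := l * R.A k with hc
  have hcpos : 0 < c := mul_pos hl (R.A_pos k)
  set Γ : ℝ := ∫ η, PlanarEigenmode.vorticity (v 0) η with hΓ
  have hΓ0 : 0 ≤ Γ := integral_nonneg fun η => (hpos 0 h0 η).le
  have hceil := palasekTowerBreakdown_anyProfile_childSwirl_ceiling_clock R k hl hS' hv hω hBS hpos hlog hsc h0
    hs1 hτs y
  have hthr := palasekTowerBreakdown_anyProfile_childSwirl_relaxation_threshold R k hl hS' hv hω hBS hpos hlog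
    hsc h0 hs1 hτs (δ := δ) hclock y
  have hB := norm_biotSavart2D_burgersSlice_le hcpos hΓ0 y
  have htri := norm_le_norm_add_norm_sub'
    (exp (c * s / 2) • v ((exp (c * s) - 1) / c) (exp (c * s / 2) • y))
    (biotSavart2D (fun y' => burgersVorticity c 1 Γ (embedXY y')) y)
  have hunit : 0 ≤ Γ * Real.sqrt c := by positivity
  have h4π : Γ * Real.sqrt c / (4 * π) ≤ 0.0796 * (Γ * Real.sqrt c) := by
    rw [div_eq_inv_mul]
    exact mul_le_mul_of_nonneg_right inv_four_pi_le_d4 hunit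
  linarith

end Summit.NavierStokesRegularity.FluidComputer.PalasekTowerClayBridge
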